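import Literature.NumberTheory.EllipticCurves.Kato2004.ZetaClassOnRankLeOneBranch
import Summits.BirchSwinnertonDyer.Rank1Residual.X12.CMSevenAwayFromSeven
import Summits.BirchSwinnertonDyer.Rank1Residual.Additive.RamifiedSevenPrimitiveAdmissibleMember
import HarnessLib

set_option autoImplicit false
set_option linter.dupNamespace false

/-!
# (R3c) at Kato's member — the ingredient census made KERNEL (crux 19945, stub (E2); cell ruling D962)

Seat bsd-idea-20 g69 (ideator, crux-level, W-71/W-79: publish-only; nothing here is registered, no stub of
`Lines/kato_perrin_riou_zp.lean` v14 (sha16 6f202717661c60d4) is touched).  Companion memo: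
`Cruxes/EllipticUnitValueSevenOfGZK/R3cIngredients-g69.md`.  HONEST LABEL: nothing closes; (E2) is NOT proved;
19945 stays OPEN; no summit statement is proved by this file.

D962 (bsd-cm STATUS l.3833) split the member-realisation fact as `F•₇ := F•₇′ ∧ (R3c)`, `(R3c) := 0 ≤ v₇(ϖ/(q·q⁻))`
«a kernel lemma at `W_K` from typed §13.12–13.14 ingredients».  This file certifies, in the kernel, the three
facts the memo's census rests on:

* §1 **SCALE AUDIT** — the position clause of ★ (`Kato2004.ZetaClassPositionBody`) and every print clause of a
  realised family survive the rescaling `y ↦ p • y` (constant `q ↦ p·q`), which LOWERS `e` by one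
  (`position_rescale_pos/nonpos`, `exponent_mul_prime`).  Hence «∀ realised families at `W_K`, `0 ≤ e`» is false as
  soon as one family exists, and `(R3c)` has no referent outside the existential package of `F•₇′`: it is a
  clause about THE witness (or about a Skolemised constant), never a closed `Prop` beside `F•₇′`.
* §2 **THE ONE INGREDIENT, scalar shadow** — if the witness constant satisfies the member transport identity
  `q·q⁻ = u·ϖ` with `v_p(u) = 0` (Kato Thm. 12.5 (1) transported along `h¹(W_K) ≅ M(f)` in the Néron coordinate —
  the reading ALREADY of record in `Kato2004/MemberHullInputs.lean` (p439134) at `χ = 1`, here needed at every `χ`;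
  memo §2 proves `u` is `χ`-independent and a `p`-unit by functoriality), then `e = 0`, whence `(R3c)`
  (`exponent_eq_zero_of_transport`, `exponent_nonneg_of_transport`); and the CANONICAL letter `q := ϖ/q⁻` makes
  `e = 0` definitional (`exponent_eq_zero_of_canonical`).
* §3 **ROAD-ALT (a v15 option for the pen, not the port's)** — «★ holds at the member with `k = 0`»
  (`MemberZetaIntegral`: Kato Thm. 12.6 p. 222 + §13.14 p. 234 ll. 1–6 VERBATIM at `T = V_{O_λ}(f)`, freeness of the
  pin from the tree) gives an ADMISSIBLE class from ANY realised family by the tree's one-liner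
  `isAdmissibleZetaClass_of_zero` — no `μ`-free clause, no `e`, no (R3c) (`exists_isAdmissibleZetaClass_of_memberZetaIntegral`,
  and the `𝒞₇`-packaged form `admissibleMemberSeven_of_memberZetaIntegral` = conjunct (i) of 2★'s output shape).

References: [Kato2004Asterisque] Thm. 12.4 (2)(3), Thm. 12.5 (1)(4) (pp. 221–222), Thm. 12.6 (p. 222), §13.9 and
Lemma 13.10 (1) (pp. 229–230), §13.12–13.14 (pp. 231–234); [BlochKato1990] §3 (naturality of `exp*`);
[Faltings1989]/[Tsuji1999] (functoriality of the comparison isomorphisms); tree: `Kato2004/ZetaClassOnRankLeOneBranch.lean`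
(★, (D1), §6), `Kato2004/MemberHullInputs.lean` (reading of record p439134), `Kato2004/MemberMultiplierInputs.lean`
((m1)–(m4)), `Rank1Residual/Additive/RamifiedSevenPrimitiveAdmissibleMember.lean` (freeness at `𝒞₇`).
-/

noncomputable section

open scoped Classical NumberField
open WeierstrassCurve Literature.NumberTheory.EllipticCurves
open Literature.NumberTheory.EllipticCurves.Rank1Residual
open Literature.NumberTheory.EllipticCurves.IwasawaAlgebra
open Literature.NumberTheory.EllipticCurves.Kato2004
open Summit.BirchSwinnertonDyer.Rank1Residual
open Summit.BirchSwinnertonDyer.Rank1Residual.Additive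

namespace Summit.BirchSwinnertonDyer.BirchSwinnertonDyer.Cruxes.EllipticUnitValueSevenOfGZK.R3cIngredients

/-! ## §1 Scale audit: `y ↦ p • y`, `q ↦ p·q` keeps the position and lowers `e` by one -/

section Scale

variable {Λ : Type*} [CommRing Λ] {H : Type*} [AddCommGroup H] [Module Λ H]

/-- Branch `e = n + 1 ≥ 1` of ★'s position `((P^{(−e)⁺}·M) • z = (u·P^{e⁺}·P^k) • y`: after `y ↦ P • y` the same
position holds with `e − 1 = n`. Kernel. [cite: Kato2004Asterisque, Lemma 13.10 (1) (p. 230)] -/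
theorem position_rescale_pos (P M u : Λ) (n k : ℕ) (z y : H)
    (h : M • z = (u * P ^ (n + 1) * P ^ k) • y) :
    M • z = (u * P ^ n * P ^ k) • (P • y) := by
  rw [h, ← mul_smul]
  congr 1
  ring

/-- Branch `e = −n ≤ 0`: position `(P^n·M) • z = (u·P^k) • y`; after `y ↦ P • y` it holds with `e − 1 = −(n+1)`.
Kernel. [cite: Kato2004Asterisque, Lemma 13.10 (1) (p. 230)] -/
theorem position_rescale_nonpos (P M u : Λ) (n k : ℕ) (z y : H)
    (h : (P ^ n * M) • z = (u * P ^ k) • y) :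
    (P ^ (n + 1) * M) • z = (u * P ^ k) • (P • y) := by
  calc (P ^ (n + 1) * M) • z = P • ((P ^ n * M) • z) := by
        rw [← mul_smul]
        congr 1
        ring
    _ = P • ((u * P ^ k) • y) := by rw [h]
    _ = (u * P ^ k) • (P • y) := by
        rw [← mul_smul, ← mul_smul]
        congr 1
        ring

end Scale

section Valuation

variable {p : ℕ} [hp : Fact p.Prime]

/-- The exponent `e(q) = v_p(ϖ/(q·q⁻))` of a realised family drops by one under `q ↦ p·q` (the values of `p • y`).
Kernel. [cite: Kato2004Asterisque, Thm. 12.5 (1) (p. 221)] -/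
theorem exponent_mul_prime (ϖ q qm : ℚ) (hϖ : ϖ ≠ 0) (hq : q ≠ 0) (hqm : qm ≠ 0) :
    padicValRat p (ϖ / ((p * q) * qm)) = padicValRat p (ϖ / (q * qm)) - 1 := by
  have hp0 : (p : ℚ) ≠ 0 := by exact_mod_cast hp.out.ne_zero
  have h1 : ϖ / ((p * q) * qm) = (ϖ / (q * qm)) / p := by
    field_simp
  rw [h1, padicValRat.div (div_ne_zero hϖ (mul_ne_zero hq hqm)) hp0, padicValRat.self hp.out.one_lt]

/-- Iterating: `e(p^m·q) = e(q) − m` — every integer below `e(q)` is the exponent of some rescaled family, so no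
universally quantified lower bound on `e` can hold once one family exists. Kernel. -/
theorem exponent_mul_prime_pow (ϖ q qm : ℚ) (hϖ : ϖ ≠ 0) (hq : q ≠ 0) (hqm : qm ≠ 0) (m : ℕ) :
    padicValRat p (ϖ / ((p ^ m * q) * qm)) = padicValRat p (ϖ / (q * qm)) - m := by
  induction m with
  | zero => simp
  | succ m ih =>
    have hp0 : (p : ℚ) ≠ 0 := by exact_mod_cast hp.out.ne_zero
    have hq' : (p : ℚ) ^ m * q ≠ 0 := mul_ne_zero (pow_ne_zero _ hp0) hq
    rw [show (p : ℚ) ^ (m + 1) * q = p * (p ^ m * q) by ring, exponent_mul_prime ϖ _ qm hϖ hq' hqm, ih]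
    push_cast
    ring

/-- **No free-standing `hR3c`.** Abstract certificate behind memo §1: if a family predicate indexed by its witness
constant, `Fam : ℚ → Prop` (read: «the body of `F•₇′` with this `q`»), is closed under the rescaling `q ↦ p·q` (all
clauses (C1)–(C5) of `ZetaBody`, the realisation clause `I.proj n y = levelToLayer … (z (n+1) …)` and (RES)/(DEF) of
`DefinedExpStarBody` are `ℤ_p`-linear resp. `q`-free — by inspection of the tree letters, not unfolded here), then a
SEPARATE hypothesis «every witness has `0 ≤ e`» contradicts the existence of one witness.  So (R3c) can only be a
clause INSIDE the existential package (or a statement about a canonically normalised constant).  Kernel. -/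
theorem false_of_forall_exponent_nonneg (ϖ qm : ℚ) (hϖ : ϖ ≠ 0) (hqm : qm ≠ 0) (Fam : ℚ → Prop)
    (hscale : ∀ q, Fam q → Fam (p * q))
    (hR3c : ∀ q, q ≠ 0 → Fam q → 0 ≤ padicValRat p (ϖ / (q * qm)))
    (q₀ : ℚ) (hq₀ : q₀ ≠ 0) (h₀ : Fam q₀) : False := by
  have hp0 : (p : ℚ) ≠ 0 := by exact_mod_cast hp.out.ne_zero
  have hpow : ∀ m : ℕ, Fam (p ^ m * q₀) := by
    intro m
    induction m with
    | zero => simpa using h₀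
    | succ m ih =>
      have := hscale _ ih
      simpa [pow_succ, mul_comm, mul_assoc, mul_left_comm] using this
  set m : ℕ := (padicValRat p (ϖ / (q₀ * qm))).toNat + 1 with hm
  have h1 := hR3c (p ^ m * q₀) (mul_ne_zero (pow_ne_zero _ hp0) hq₀) (hpow m)
  rw [exponent_mul_prime_pow ϖ q₀ qm hϖ hq₀ hqm m] at h1
  have h2 : padicValRat p (ϖ / (q₀ * qm)) ≤ ((padicValRat p (ϖ / (q₀ * qm))).toNat : ℤ) := Int.self_le_toNat _
  simp only [hm] at h1
  push_cast at h1
  linarith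

/-! ## §2 The one ingredient (member transport of the value law), scalar shadow: `q·q⁻ = u·ϖ`, `v_p(u) = 0 ⟹ e = 0` -/

/-- **(R3c⁼) from the transport unit.** If the witness constant `q` of the realised family at Kato's member and the
print scalars `q⁻ = qm`, `ϖ` (`Ω⁺_f = ϖ·Ω_{W_K}`) satisfy `q·qm = u·ϖ` with `u` a `p`-adic unit (Kato Thm. 12.5 (1)
transported along `h¹(W_K) ≅ M(f)` in the Néron coordinate, composed with Lemma 13.10 (1); memo §2–§3), then
`e = v_p(ϖ/(q·qm)) = 0`. Kernel. [cite: Kato2004Asterisque, Thm. 12.5 (1) (p. 221), Lemma 13.10 (1) (p. 230)] -/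
theorem exponent_eq_zero_of_transport (ϖ q qm u : ℚ) (hϖ : ϖ ≠ 0) (hu0 : u ≠ 0)
    (hu : padicValRat p u = 0) (h : q * qm = u * ϖ) : padicValRat p (ϖ / (q * qm)) = 0 := by
  rw [h, padicValRat.div hϖ (mul_ne_zero hu0 hϖ), padicValRat.mul hu0 hϖ, hu]
  ring

/-- **(R3c) as the consumer needs it** (`0 ≤ e`), from the same identity. Kernel.
[cite: Kato2004Asterisque, Thm. 12.5 (1) (p. 221), Lemma 13.10 (1) (p. 230)] -/
theorem exponent_nonneg_of_transport (ϖ q qm u : ℚ) (hϖ : ϖ ≠ 0) (hu0 : u ≠ 0)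
    (hu : padicValRat p u = 0) (h : q * qm = u * ϖ) : 0 ≤ padicValRat p (ϖ / (q * qm)) :=
  (exponent_eq_zero_of_transport ϖ q qm u hϖ hu0 hu h).ge

end Valuation

section Canonical

variable {p : ℕ}

/-- **The CANONICAL letter**: with the witness constant chosen as `q := ϖ/q⁻` (the family rescaled by the rational
`p`-unit `u⁻¹`), `e = 0` is definitional and (R3c) needs no clause. Kernel. -/
theorem exponent_eq_zero_of_canonical (ϖ qm : ℚ) (hϖ : ϖ ≠ 0) (hqm : qm ≠ 0) :
    padicValRat p (ϖ / ((ϖ / qm) * qm)) = 0 := by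
  rw [div_mul_cancel₀ ϖ hqm, div_self hϖ]
  simp

/-- … and its `0 ≤ e` form. Kernel. -/
theorem exponent_nonneg_of_canonical (ϖ qm : ℚ) (hϖ : ϖ ≠ 0) (hqm : qm ≠ 0) :
    0 ≤ padicValRat p (ϖ / ((ϖ / qm) * qm)) :=
  (exponent_eq_zero_of_canonical ϖ qm hϖ hqm).ge

end Canonical

/-! ## §3 ROAD-ALT: ★ at the member with `k = 0` (Thm. 12.6 + §13.14) ⟹ an admissible class from ANY realised family -/

/-- **«★ holds at `W` with `k = 0` on every FREE pin»** — the transcription, in the tree's existing currency, of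
Kato Thm. 12.6 (p. 222: `Z ⊂ Z(f,T)`, `Z(f,T)/Z` finite, at `T = V_{O_λ}(f)`) with §13.14 (p. 234, verbatim: «since
`Z(f,T)/Z` is a finite group, `Z(f,T)_𝔭 ⊂ 𝐇¹(T)_𝔭` for any prime ideal `𝔭` of `Λ` of height one. Since `𝐇¹(T)` is a
free `Λ`-module … this means `Z(f,T) ⊂ 𝐇¹(T)`») AT KATO'S MEMBER `W = W_K` (`T_pW_K ≅ V_{ℤ_p}(f)(1)`): the
`Ω_{W_K}`-normalised class `𝐳_{γ_{W_K}}` (a `Λ^×`-multiple of Kato's `z_{γ⁰}`, `γ⁰` a generator of `T(−1)⁺` — the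
member transport reading of `MemberHullInputs.lean`) is INTEGRAL, i.e. ★'s witness can be taken with `k = 0`.
A `Prop` (hypothesis shape, meaningful at the member only); nothing asserted.
[cite: Kato2004Asterisque, Thm. 12.6 (p. 222), §13.14 (p. 234), Thm. 12.5 (1) (p. 221)] -/
@[cite "Kato2004Asterisque" "Thm. 12.6 (p. 222); §13.14 (p. 234)"]
def MemberZetaIntegral (W : WeierstrassCurve ℚ) [W.IsElliptic] [W.IsGloballyMinimal] (p : ℕ) [Fact p.Prime]
    [ContinuousSMul ℤ_[p] (W.tateModule p)] : Prop :=
  ∀ (K : ZpExtension ℚ p) (hK : K.IsCyclotomic) (γ : Field.absoluteGaloisGroup ℚ), K.IsTopGenerator γ →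
    ∀ I : IwasawaH1Data W p K γ, Module.Free (IwasawaAlgebra p) I.H →
      ∃ z₁ : I.H, ZetaClassPosition W p K hK I 0 z₁

/-- **ROAD-ALT, kernel**: «★ with `k = 0`» and ANY realised value-pinned family (no `μ`-free clause, no sign of `e`)
give an ADMISSIBLE Kato zeta class of a free pin — the tree's `isAdmissibleZetaClass_of_zero`.
[cite: Kato2004Asterisque, Thm. 12.5 (1) (p. 221), Thm. 12.6 (p. 222), §13.14 (p. 234), Conj. 12.10 (p. 224)] -/
theorem exists_isAdmissibleZetaClass_of_memberZetaIntegral {W : WeierstrassCurve ℚ} [W.IsElliptic]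
    [W.IsGloballyMinimal] {p : ℕ} [Fact p.Prime] [ContinuousSMul ℤ_[p] (W.tateModule p)]
    (h0 : MemberZetaIntegral W p) {K : ZpExtension ℚ p} (hK : K.IsCyclotomic) {γ : Field.absoluteGaloisGroup ℚ}
    (hγ : K.IsTopGenerator γ) (I : IwasawaH1Data W p K γ) [hF : Module.Free (IwasawaAlgebra p) I.H]
    (hR : HasRealisedZetaFamily W p K hK I) : ∃ z₀ : I.H, IsAdmissibleZetaClass W p K hK I z₀ := by
  obtain ⟨z₁, hz₁⟩ := h0 K hK γ hγ I hF
  exact ⟨z₁, exists_zetaClassPosition_of_rank_le_one.isAdmissibleZetaClass_of_zero hK hγ hz₁ hR⟩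

/-- **(E2⁰) — the ROAD-ALT letter for `𝒞₇`**: every `W ∈ 𝒞₇` is `ℚ`-isogenous to a globally minimal member `W′` on
all of whose cyclotomic pins SOME value-pinned family is realised (`Kato2004.HasRealisedZetaFamily`, = (R0)–(R2) of
`F•₇′`, no `μ`-free clause, no `e`) AND ★ holds with `k = 0` on the free pins (`MemberZetaIntegral`).  A `Prop`
(hypothesis shape); nothing asserted.
[cite: Kato2004Asterisque, (8.1.3) (p. 180), Prop. 8.12 (p. 186), Thm. 9.7 (p. 189), Thm. 12.6 (p. 222), §13.14 (p. 234)] -/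
@[cite "Kato2004Asterisque" "(8.1.3) (p. 180); Thm. 9.7 (p. 189); Thm. 12.6 (p. 222); §13.14 (p. 234)"]
def ClassCSevenMemberZetaIntegral : Prop :=
  ∀ (W : WeierstrassCurve ℚ) [W.IsElliptic] [W.IsGloballyMinimal] [Fact (Nat.Prime 7)], X12.ClassCSeven W →
    ∃ (W' : WeierstrassCurve ℚ) (_ : W'.IsElliptic) (_ : W'.IsGloballyMinimal), IsIsogenous W W' ∧
      letI : ContinuousSMul ℤ_[7] (W'.tateModule 7) := TateModule.continuousSMul_padicInt
      (∀ (K : ZpExtension ℚ 7) (hK : K.IsCyclotomic) (γ : Field.absoluteGaloisGroup ℚ) (_ : K.IsTopGenerator γ)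
        (I : IwasawaH1Data W' 7 K γ), HasRealisedZetaFamily W' 7 K hK I) ∧
      MemberZetaIntegral W' 7

/-- **ROAD-ALT reaches conjunct (i) of 2★'s output shape** (an admissible class at an isogenous member, on the
standard cyclotomic pin) from (E2⁰) ALONE — no ★-fact binder, no GZK, no (E2): the member `W′ ∈ 𝒞₇`
(`X12.ClassCSeven.of_isIsogenous`), freeness of its pins by the tree (`7 ∤ #W′(ℚ)_tors` on `𝒞₇`,
`KatoMuResidual.torsionBy_eq_bot_of_not_dvd_torsionOrder`, `IwasawaH1Data.moduleFree_of_torsionBy_eq_bot`), then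
`exists_isAdmissibleZetaClass_of_memberZetaIntegral`.  Kernel; CONDITIONAL on (E2⁰); nothing closes.
[cite: Kato2004Asterisque, Thm. 12.5 (1) (p. 221), Thm. 12.6 (p. 222), §13.14 (p. 234), Conj. 12.10 (p. 224)] -/
theorem admissibleMemberSeven_of_memberZetaIntegral (h : ClassCSevenMemberZetaIntegral) :
    ∀ (W : WeierstrassCurve ℚ) [W.IsElliptic] [W.IsGloballyMinimal] [Fact (Nat.Prime 7)], X12.ClassCSeven W →
      ∃ (W' : WeierstrassCurve ℚ) (_ : W'.IsElliptic) (_ : W'.IsGloballyMinimal), IsIsogenous W W' ∧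
        letI : ContinuousSMul ℤ_[7] (W'.tateModule 7) := TateModule.continuousSMul_padicInt
        ∃ (K : ZpExtension ℚ 7) (hK : K.IsCyclotomic) (γ : Field.absoluteGaloisGroup ℚ) (_ : K.IsTopGenerator γ)
          (I : IwasawaH1Data W' 7 K γ) (z₀ : I.H), IsAdmissibleZetaClass W' 7 K hK I z₀ := by
  intro W _ _ _ hC
  obtain ⟨W', hE', hM', hiso, hfam, h0⟩ := h W hC
  haveI := hE'
  haveI := hM'
  have hC' : X12.ClassCSeven W' := hC.of_isIsogenous hiso
  refine ⟨W', hE', hM', hiso, ?_⟩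
  letI : ContinuousSMul ℤ_[7] (W'.tateModule 7) := TateModule.continuousSMul_padicInt
  have hK : (CyclotomicZp.zpExtension 7).IsCyclotomic := CyclotomicZp.isCyclotomic_zpExtension 7
  obtain ⟨γ, hγ, -⟩ := CyclotomicZp.exists_isTopGenerator_zpExtension 7
  obtain ⟨I⟩ := nonempty_iwasawaH1Data_holds W' 7 (CyclotomicZp.zpExtension 7) γ hK hγ
  haveI : Module.Free (IwasawaAlgebra 7) I.H :=
    I.moduleFree_of_torsionBy_eq_bot hK hγ
      (KatoMuResidual.torsionBy_eq_bot_of_not_dvd_torsionOrder W' 7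
        (Summit.BirchSwinnertonDyer.BirchSwinnertonDyer.Theorems.RamifiedSevenEllipticUnits.ValueOfKMCPerrinRiou.not_seven_dvd_torsionOrder
          W' hC'))
  obtain ⟨z₀, hz₀⟩ := exists_isAdmissibleZetaClass_of_memberZetaIntegral h0 hK hγ I (hfam _ hK γ hγ I)
  exact ⟨CyclotomicZp.zpExtension 7, hK, γ, hγ, I, z₀, hz₀⟩

/-! ## Audit: what this file does NOT do -/

-- It does not state or prove (E2) (`stub_muFreeRealisedFamilySeven`), `F•₇`, `F•₇′`, (ING-Ω) in value currency, or
-- the v14 composition; it registers nothing (`ledger skeleton check` is NOT run on it, W-79); `MemberZetaIntegral` and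
-- `ClassCSevenMemberZetaIntegral` are hypothesis SHAPES whose print homes (if the pen adopts ROAD-ALT) would be
-- `Literature/NumberTheory/EllipticCurves/Kato2004/…` by a typer, not this seat.

end Summit.BirchSwinnertonDyer.BirchSwinnertonDyer.Cruxes.EllipticUnitValueSevenOfGZK.R3cIngredients

end
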